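import Summits.ValiantsHypothesis.ValiantsHypothesis.Theorems.DefinabilityGapPrivateFree
import Literature.Probability.Moments.BennettBernstein
import Literature.Computability.Complexity.HardCoreMinMax
import HarnessLib

/-!
# Definability gap, ROAD P: active shared killers and the crowded-line bound (N1 v2 (c))

Completes step (c) of the existence proof of pivot certificates (NODE-v7 §H / PLAN-N1-v2).
With the activity predicate `fun j b => r b = τ j` of `DefinabilityGapPrivateFree`:

* `fAS K τ J b a` — indicator that the shared killer `b`, placed at value `a`, is active at some
  cell of `J` containing it; `sum_fAS_eq_card : Σ_b fAS b (r b) = #activeShared`;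
* `sharedLoad w K τ J = Σ_{b ∈ shared} Σ_{j ∈ J, b ∈ K j} w_b(τ j)` bounds its mean
  (`mean_fAS_le_sharedLoad`) and is itself at most the pair weight
  `pairWeight (ω w K τ) J` (`sharedLoad_le_pairWeight`), which the sparse-subfamily averaging
  (`exists_powersetCard_pairWeight_le`) makes small;
* `weight_activeShared_le` — Bernstein upper tail `W{#activeShared ≥ A + t} ≤ e^{−t²/(2(A+t/3))}`
  for any `A ≥ sharedLoad`, `A > 0`;
* **`weight_fewFree_le`** — the crowded-line bound: combining with `card_privFree_le` and
  `weight_fewPrivFree_le`,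
  `W{#free(J) < θ·#J/2 − 2(A + t)} ≤ exp(−θ·#J/8) + exp(−t²/(2(A + t/3)))`.
-/

namespace Summit.ValiantsHypothesis.ValiantsHypothesis.Theorems.DefinabilityGapActiveShared

open Finset Real Literature.Probability.Moments
open Literature.Computability.Complexity.HardCoreMinMax
open Summit.ValiantsHypothesis.ValiantsHypothesis.Theorems.DefinabilityGapSparseSubfamily
open Summit.ValiantsHypothesis.ValiantsHypothesis.Theorems.DefinabilityGapPrivateFree

variable {α β Γ : Type*} [DecidableEq α] [DecidableEq β] [DecidableEq Γ]

/-- Indicator: the killer `b` is shared within `J` and, placed at value `a`, active at some cell of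
`J` containing it. [lens-5 g7] -/
def fAS (K : α → Finset β) (τ : α → Γ) (J : Finset α) (b : β) (a : Γ) : ℝ :=
  if b ∈ shared K J ∧ ∃ j ∈ J, b ∈ K j ∧ a = τ j then 1 else 0

/-- `0 ≤ fAS`. -/
theorem fAS_nonneg (K : α → Finset β) (τ : α → Γ) (J : Finset α) (b : β) (a : Γ) :
    0 ≤ fAS K τ J b a := by
  unfold fAS; split_ifs <;> norm_num

/-- `fAS ≤ 1`. -/
theorem fAS_le_one (K : α → Finset β) (τ : α → Γ) (J : Finset α) (b : β) (a : Γ) :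
    fAS K τ J b a ≤ 1 := by
  unfold fAS; split_ifs <;> norm_num

/-- `Σ_b fAS b (r b) = #activeShared` for the activity predicate `fun j b => r b = τ j`.
[lens-5 g7] -/
theorem sum_fAS_eq_card [Fintype β] (K : α → Finset β) (τ : α → Γ) (J : Finset α)
    (r : β → Γ) :
    ∑ b, fAS K τ J b (r b) = ((activeShared K (fun j b => r b = τ j) J).card : ℝ) := by
  unfold fAS activeShared
  rw [Finset.sum_boole]
  congr 2
  ext b
  simp only [Finset.mem_filter, Finset.mem_univ, true_and]

/-- The SHARED LOAD `Σ_{b ∈ shared K J} Σ_{j ∈ J, b ∈ K j} w_b(τ j)`: an upper bound for the mean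
number of active shared killers. [lens-5 g7] -/
def sharedLoad (w : β → Γ → ℝ) (K : α → Finset β) (τ : α → Γ) (J : Finset α) : ℝ :=
  ∑ b ∈ shared K J, ∑ j ∈ J.filter (fun j => b ∈ K j), w b (τ j)

omit [DecidableEq α] [DecidableEq β] [DecidableEq Γ] in
/-- An indicator of a finite union is at most the sum of the indicators. -/
theorem ite_exists_le_sum (J : Finset α) (p : α → Prop) [DecidablePred p] :
    (if ∃ j ∈ J, p j then (1 : ℝ) else 0) ≤ ∑ j ∈ J, (if p j then (1 : ℝ) else 0) := by
  by_cases h : ∃ j ∈ J, p j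
  · obtain ⟨j, hj, hpj⟩ := h
    rw [if_pos ⟨j, hj, hpj⟩]
    calc (1 : ℝ) = (if p j then (1 : ℝ) else 0) := by rw [if_pos hpj]
      _ ≤ ∑ j ∈ J, (if p j then (1 : ℝ) else 0) :=
          Finset.single_le_sum (f := fun j => if p j then (1 : ℝ) else 0)
            (fun j _ => by split_ifs <;> norm_num) hj
  · rw [if_neg h]
    exact Finset.sum_nonneg fun j _ => by positivity

/-- **Mean of the active-shared count** `≤ sharedLoad`. [lens-5 g7] -/
theorem mean_fAS_le_sharedLoad [Fintype β] [Fintype Γ] {w : β → Γ → ℝ} (hw : ∀ b a, 0 ≤ w b a)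
    (K : α → Finset β) (τ : α → Γ) (J : Finset α) :
    ∑ b, ∑ a, w b a * fAS K τ J b a ≤ sharedLoad w K τ J := by
  -- off `shared` the indicator vanishes
  have hzero : ∀ b ∉ shared K J, ∑ a, w b a * fAS K τ J b a = 0 := by
    intro b hb
    refine Finset.sum_eq_zero fun a _ => ?_
    unfold fAS
    rw [if_neg (fun h => hb h.1), mul_zero]
  rw [← Finset.sum_subset (Finset.subset_univ (shared K J)) (fun b _ hb => hzero b hb)]
  unfold sharedLoad
  refine Finset.sum_le_sum fun b hb => ?_
  -- at a shared `b`: `Σ_a w_b(a)·[∃ j, b ∈ K j ∧ a = τ j] ≤ Σ_{j : b ∈ K j} w_b(τ j)`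
  calc ∑ a, w b a * fAS K τ J b a
      ≤ ∑ a, w b a * ∑ j ∈ J.filter (fun j => b ∈ K j), (if a = τ j then (1 : ℝ) else 0) := by
        refine Finset.sum_le_sum fun a _ => mul_le_mul_of_nonneg_left ?_ (hw b a)
        unfold fAS
        rw [if_congr (Iff.intro (fun h => h.2) (fun h => ⟨hb, h⟩)) rfl rfl]
        have hre : (∃ j ∈ J, b ∈ K j ∧ a = τ j) ↔
            ∃ j ∈ J.filter (fun j => b ∈ K j), a = τ j := by
          constructor
          · rintro ⟨j, hj, hbj, ha⟩
            exact ⟨j, Finset.mem_filter.mpr ⟨hj, hbj⟩, ha⟩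
          · rintro ⟨j, hj, ha⟩
            exact ⟨j, (Finset.mem_filter.mp hj).1, (Finset.mem_filter.mp hj).2, ha⟩
        rw [if_congr hre rfl rfl]
        exact ite_exists_le_sum _ _
    _ = ∑ j ∈ J.filter (fun j => b ∈ K j), ∑ a, w b a * (if a = τ j then (1 : ℝ) else 0) := by
        rw [Finset.sum_comm]
        refine Finset.sum_congr rfl fun a _ => ?_
        rw [Finset.mul_sum]
    _ = ∑ j ∈ J.filter (fun j => b ∈ K j), w b (τ j) := by
        refine Finset.sum_congr rfl fun j _ => ?_
        simp_rw [mul_ite, mul_one, mul_zero]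
        rw [Finset.sum_ite_eq' Finset.univ (τ j) (w b)]
        simp

/-- Second moment of the active-shared count `≤` its mean (`fAS² = fAS`). -/
theorem sum_sq_fAS_le [Fintype β] [Fintype Γ] {w : β → Γ → ℝ} (hw : ∀ b a, 0 ≤ w b a)
    (K : α → Finset β) (τ : α → Γ) (J : Finset α) :
    ∑ b, ∑ a, w b a * fAS K τ J b a ^ 2 ≤ ∑ b, ∑ a, w b a * fAS K τ J b a := by
  refine Finset.sum_le_sum fun b _ => Finset.sum_le_sum fun a _ => ?_
  have h0 := fAS_nonneg K τ J b a
  have h1 := fAS_le_one K τ J b a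
  nlinarith [mul_nonneg (hw b a) h0]

/-- **Upper tail for the active shared killers** (Bernstein, `b = 1`): for `A ≥ sharedLoad`,
`A > 0`, `t > 0`, the assignments with `Σ_b fAS b (r b) ≥ A + t` weigh at most
`exp(−t²/(2(A + t/3)))`. [lens-5 g7] -/
theorem weight_activeShared_le [Fintype β] [Fintype Γ] {w : β → Γ → ℝ}
    (hw : ∀ b a, 0 ≤ w b a) (hw1 : ∀ b, ∑ a, w b a = 1) (K : α → Finset β) (τ : α → Γ)
    (J : Finset α) {A t : ℝ} (hA : sharedLoad w K τ J ≤ A) (hApos : 0 < A) (ht : 0 < t) :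
    ∑ r ∈ (Finset.univ : Finset (β → Γ)).filter
        (fun r => A + t ≤ ∑ b, fAS K τ J b (r b)), prodWeight w r
      ≤ exp (-(t ^ 2 / (2 * (A + 1 * t / 3)))) := by
  have hμ : ∑ b, ∑ a, w b a * fAS K τ J b a ≤ A :=
    (mean_fAS_le_sharedLoad hw K τ J).trans hA
  have hv : ∑ b, ∑ a, w b a * fAS K τ J b a ^ 2 ≤ A := (sum_sq_fAS_le hw K τ J).trans hμ
  have hB := bernstein (ι := β) (Γ := Γ) hw hw1 (fAS K τ J) (b := 1) one_pos
    (fun b a => fAS_le_one K τ J b a) hApos hv ht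
  refine le_trans (Finset.sum_le_sum_of_subset_of_nonneg ?_
    fun r _ _ => prodWeight_nonneg hw r) hB
  intro r hr
  rw [Finset.mem_filter] at hr ⊢
  refine ⟨Finset.mem_univ _, ?_⟩
  rw [Finset.sum_sub_distrib]
  linarith [hr.2]

/-! ## The shared load is a pair weight -/

/-- The pair weight kernel `ω j j' = Σ_{b ∈ K j ∩ K j'} w_b(τ j)`. [lens-5 g7] -/
def omega (w : β → Γ → ℝ) (K : α → Finset β) (τ : α → Γ) (j j' : α) : ℝ :=
  ∑ b ∈ K j ∩ K j', w b (τ j)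

omit [DecidableEq Γ] in
/-- **`sharedLoad ≤ pairWeight ω J`**: every shared killer of a cell `j ∈ J` lies in `K j ∩ K j'`
for some other `j' ∈ J`. [lens-5 g7] -/
theorem sharedLoad_le_pairWeight {w : β → Γ → ℝ} (hw : ∀ b a, 0 ≤ w b a) (K : α → Finset β)
    (τ : α → Γ) (J : Finset α) :
    sharedLoad w K τ J ≤ pairWeight (omega w K τ) J := by
  unfold sharedLoad pairWeight omega
  -- exchange the sums: `Σ_{b ∈ shared} Σ_{j ∈ J, b ∈ K j} = Σ_{j ∈ J} Σ_{b ∈ shared, b ∈ K j}`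
  have hswap : ∑ b ∈ shared K J, ∑ j ∈ J.filter (fun j => b ∈ K j), w b (τ j) =
      ∑ j ∈ J, ∑ b ∈ (shared K J).filter (fun b => b ∈ K j), w b (τ j) := by
    simp_rw [Finset.sum_filter]
    rw [Finset.sum_comm]
  rw [hswap]
  refine Finset.sum_le_sum fun j hj => ?_
  -- the shared killers of `j` lie in `⋃_{j' ≠ j} (K j ∩ K j')`
  have hsub : (shared K J).filter (fun b => b ∈ K j) ⊆
      (J.erase j).biUnion fun j' => K j ∩ K j' := by
    intro b hb
    rw [Finset.mem_filter] at hb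
    obtain ⟨j₁, hj₁, j₂, hj₂, hne, hb₁, hb₂⟩ := (mem_shared K).mp hb.1
    rw [Finset.mem_biUnion]
    by_cases h1 : j₁ = j
    · refine ⟨j₂, Finset.mem_erase.mpr ⟨fun h => hne (h1.trans h.symm), hj₂⟩, ?_⟩
      exact Finset.mem_inter.mpr ⟨hb.2, hb₂⟩
    · refine ⟨j₁, Finset.mem_erase.mpr ⟨h1, hj₁⟩, ?_⟩
      exact Finset.mem_inter.mpr ⟨hb.2, hb₁⟩
  calc ∑ b ∈ (shared K J).filter (fun b => b ∈ K j), w b (τ j)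
      ≤ ∑ b ∈ (J.erase j).biUnion (fun j' => K j ∩ K j'), w b (τ j) :=
        Finset.sum_le_sum_of_subset_of_nonneg hsub fun b _ _ => hw b (τ j)
    _ ≤ ∑ j' ∈ J.erase j, ∑ b ∈ K j ∩ K j', w b (τ j) :=
        sum_biUnion_le_sum (J.erase j) (fun j' => K j ∩ K j') (fun b => w b (τ j))
          fun b => hw b (τ j)

/-! ## The crowded-line bound -/

open scoped Classical in
/-- **Crowded-line bound.**  Killers lie in at most two killer sets of cells of `J`; each private
block keeps its cell free with probability `≥ θ ≥ 0`; `A ≥ sharedLoad`, `A > 0`, `t > 0`.  Then the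
assignments under which fewer than `θ·#J/2 − 2(A + t)` cells of `J` are free weigh at most
`exp(−θ·#J/8) + exp(−t²/(2(A + t/3)))`. [lens-5 g7] -/
theorem weight_fewFree_le [Fintype β] [Fintype Γ] {w : β → Γ → ℝ} (hw : ∀ b a, 0 ≤ w b a)
    (hw1 : ∀ b, ∑ a, w b a = 1) (K : α → Finset β) (τ : α → Γ) (J : Finset α)
    (htwo : ∀ b, (J.filter fun j => b ∈ K j).card ≤ 2) {θ : ℝ} (hθ0 : 0 ≤ θ)
    (hθ : ∀ j ∈ J, θ ≤ ∏ b ∈ priv K J j, (1 - w b (τ j))) {A t : ℝ}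
    (hA : sharedLoad w K τ J ≤ A) (hApos : 0 < A) (ht : 0 < t) :
    ∑ r ∈ (Finset.univ : Finset (β → Γ)).filter
        (fun r => ((J.filter (free K (fun j b => r b = τ j))).card : ℝ) <
          θ * J.card / 2 - 2 * (A + t)), prodWeight w r
      ≤ exp (-(θ * J.card / 8)) + exp (-(t ^ 2 / (2 * (A + 1 * t / 3)))) := by
  set S₁ := (Finset.univ : Finset (β → Γ)).filter
    (fun r => ∑ j ∈ J, gPF K τ J r j ≤ θ * J.card / 2) with hS₁
  set S₂ := (Finset.univ : Finset (β → Γ)).filter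
    (fun r => A + t ≤ ∑ b, fAS K τ J b (r b)) with hS₂
  have hcover : (Finset.univ : Finset (β → Γ)).filter
      (fun r => ((J.filter (free K (fun j b => r b = τ j))).card : ℝ) <
        θ * J.card / 2 - 2 * (A + t)) ⊆ S₁ ∪ S₂ := by
    intro r hr
    rw [Finset.mem_filter] at hr
    rw [Finset.mem_union]
    by_cases h2 : A + t ≤ ∑ b, fAS K τ J b (r b)
    · exact Or.inr (Finset.mem_filter.mpr ⟨Finset.mem_univ _, h2⟩)
    · refine Or.inl (Finset.mem_filter.mpr ⟨Finset.mem_univ _, ?_⟩)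
      push Not at h2
      have hpf := card_privFree_le K (fun j b => r b = τ j) J htwo
      have hpf' : ((J.filter (privFree K (fun j b => r b = τ j) J)).card : ℝ) ≤
          (J.filter (free K (fun j b => r b = τ j))).card +
            2 * (activeShared K (fun j b => r b = τ j) J).card := by
        exact_mod_cast hpf
      rw [sum_gPF_eq_card K τ J r]
      rw [sum_fAS_eq_card K τ J r] at h2
      linarith [hr.2]
  have hunion := Finset.sum_union_inter (s₁ := S₁) (s₂ := S₂) (f := prodWeight w)
  have hinter : 0 ≤ ∑ r ∈ S₁ ∩ S₂, prodWeight w r :=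
    Finset.sum_nonneg fun r _ => prodWeight_nonneg hw r
  have h1 : ∑ r ∈ S₁, prodWeight w r ≤ exp (-(θ * J.card / 8)) :=
    weight_fewPrivFree_le hw hw1 K τ J hθ0 hθ
  have h2 : ∑ r ∈ S₂, prodWeight w r ≤ exp (-(t ^ 2 / (2 * (A + 1 * t / 3)))) :=
    weight_activeShared_le hw hw1 K τ J hA hApos ht
  calc _ ≤ ∑ r ∈ S₁ ∪ S₂, prodWeight w r :=
        Finset.sum_le_sum_of_subset_of_nonneg hcover fun r _ _ => prodWeight_nonneg hw r
    _ ≤ ∑ r ∈ S₁, prodWeight w r + ∑ r ∈ S₂, prodWeight w r := by linarith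
    _ ≤ _ := add_le_add h1 h2

end Summit.ValiantsHypothesis.ValiantsHypothesis.Theorems.DefinabilityGapActiveShared
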